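import Summits.RiemannHypothesis.RiemannHypothesis.Theorems.SignConeConeMagnificationStubContinuation
import Summits.RiemannHypothesis.RiemannHypothesis.Theorems.SignConeConeMagnificationStubTransfer
import Summits.RiemannHypothesis.RiemannHypothesis.Theorems.SignConeConeMagnificationStubFakePNT
import Summits.RiemannHypothesis.RiemannHypothesis.Theorems.SignConeExactConeRigidityLandau
import Summits.RiemannHypothesis.RiemannHypothesis.Theorems.SignConeExactConeRigidityDirichlet

/-!
# Route SignCone, item `ExactConeRigidity` (stmt-RiemannHypothesis-16306): one EXACT-cone weight forces RH,
modulo a one-sided abscissa theorem (the exact chain assembled)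

After duality and compactness (`SignConeExactConeRigidityCompact.exists_weight_allCutoffs`) the item
`ExactConeRigidity` is the statement

  (KRH)  one weight `c ≥ 0` (`c 1 = 0`) exact-feasible against EVERY Weil test — `0 ≤ Re (W_ar - P_c)(φ ⋆ φ̃)` —
         forces the Riemann hypothesis.

This file assembles (KRH) from what the tree now has, MODULO one named analytic hypothesis of W-MAG /
fefr-rigidity type, in two variants:

* `riemannHypothesis_of_exactWeight_of_primeDeficit` — modulo the EXACT PRIME-DEFICIT THEOREM
  `Σ_p (log p - c(p))₊ p^{-σ} < ∞` (`σ > 1/2`) for exact-cone weights with (for free) `Σ c(n) n^{-σ} < ∞`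
  (`σ > 1`) and the local continuation of `L_c - 1/(s-1)` to `Re s > 1/2` (W-MAG Thm 1.2(i) at slack `M = 0`;
  the registered `stub_deficit` of crux stmt-16303 is its unit-slack twin, and IMPLIES it);
* `riemannHypothesis_of_exactWeight_of_surplus` — modulo the EXACT SURPLUS THEOREM
  `Σ_n (c(n) - Λ(n))₊ n^{-σ} < ∞` (`σ > 1/2`) (archive fefr Thm B, other side).

Everything else is in the tree: exact ⇒ unit slack; `stub_fakePNT` (bounded discrepancy,
`SignConeConeMagnificationStubFakePNT`); `LSeriesSummable_of_unitSlack` (`Σ c(n) n^{-σ} < ∞`, `σ > 1`,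
`SignConeExactConeRigidityDirichlet`); `stub_continuation` (`SignConeConeMagnificationStubContinuation`);
`stub_transfer` / `riemannHypothesis_of_fakeWeight_landau_surplus` (Landau transfers,
`SignConeConeMagnificationStubTransfer`, `SignConeExactConeRigidityLandau`).

NB (import worlds): this module lives in the import closure of `WeilGroundStateRealZeros`; the duality /
compactness files `SignConeExactConeRigidity{Cone,Duality,Compact}` live in that of `WeilWindowSimpleEven`; the
two were not co-importable until the duplicate `def WeilWindowSimpleEven` is removed (proposal p131025), after
which `ExactConeRigidity_of_…` is a five-line composition of `exists_weight_allCutoffs` with this file.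
-/

noncomputable section

-- `Summit.RiemannHypothesis.RiemannHypothesis.…` repeats a namespace component by design (D-0017 layout).
set_option linter.dupNamespace false

open scoped BigOperators ArithmeticFunction.vonMangoldt Real
open Complex MeasureTheory Set Filter LSeries

namespace Summit.RiemannHypothesis.RiemannHypothesis.Theorems.SignConeExactConeRigidity

open Literature.NumberTheory.LFunctions
open Summit.RiemannHypothesis.RiemannHypothesis.Theorems.SignCone
open Summit.RiemannHypothesis.RiemannHypothesis.Theorems.SignConeConeMagnification
open Summit.RiemannHypothesis.RiemannHypothesis.Cruxes.ConeMagnification.Sketch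

variable {c : ℕ → ℝ}

/-- An exact-feasible weight is unit-slack feasible. -/
theorem unitSlack_of_exact
    (hU0 : ∀ φ : ℝ → ℂ, IsWeilTest φ →
      0 ≤ (weilPolarTerm (weilConv φ (weilReflect φ)) + weilArchTerm (weilConv φ (weilReflect φ)) -
          ∑' n : ℕ, ((c n : ℝ) : ℂ) / (Real.sqrt n : ℂ) *
            (weilConv φ (weilReflect φ) (Real.log n) + weilConv φ (weilReflect φ) (-Real.log n))).re) :
    ∀ φ : ℝ → ℂ, IsWeilTest φ →
      -(∫ t, ‖φ t‖ ^ 2) ≤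
        (weilPolarTerm (weilConv φ (weilReflect φ)) + weilArchTerm (weilConv φ (weilReflect φ)) -
          ∑' n : ℕ, ((c n : ℝ) : ℂ) / (Real.sqrt n : ℂ) *
            (weilConv φ (weilReflect φ) (Real.log n) + weilConv φ (weilReflect φ) (-Real.log n))).re := by
  intro φ hφ
  have h1 := hU0 φ hφ
  have h2 : 0 ≤ ∫ t, ‖φ t‖ ^ 2 := integral_nonneg fun t => by positivity
  linarith

/-- **The analytic package of an exact-cone weight** (all in the tree): `Σ c(n) n^{-σ} < ∞` for `σ > 1` and
the local holomorphic continuation of `L_c(s) - 1/(s-1)` to thin rectangles through every point of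
`Re s > 1/2` (`stub_fakePNT`, `LSeriesSummable_of_unitSlack`, `stub_continuation`). -/
theorem exactWeight_continuation (hc : ∀ n, 0 ≤ c n)
    (hU0 : ∀ φ : ℝ → ℂ, IsWeilTest φ →
      0 ≤ (weilPolarTerm (weilConv φ (weilReflect φ)) + weilArchTerm (weilConv φ (weilReflect φ)) -
          ∑' n : ℕ, ((c n : ℝ) : ℂ) / (Real.sqrt n : ℂ) *
            (weilConv φ (weilReflect φ) (Real.log n) + weilConv φ (weilReflect φ) (-Real.log n))).re) :
    (∀ σ : ℝ, 1 < σ → LSeriesSummable (fun n => ((c n : ℝ) : ℂ)) σ) ∧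
      ∀ s₀ : ℂ, 1 / 2 < s₀.re → ∃ η : ℝ, 0 < η ∧ ∃ F : ℂ → ℂ,
        DifferentiableOn ℂ F {s : ℂ | 1 / 2 < s.re ∧ s.re < s₀.re + 1 ∧ s₀.im - η < s.im ∧ s.im < s₀.im + η} ∧
        ∀ s ∈ {s : ℂ | 1 / 2 < s.re ∧ s.re < s₀.re + 1 ∧ s₀.im - η < s.im ∧ s.im < s₀.im + η},
          1 < s.re → F s = LSeries (fun n => ((c n : ℝ) : ℂ)) s - 1 / (s - 1) := by
  have hU1 := unitSlack_of_exact hU0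
  have hPNT := stub_fakePNT c hc hU1
  have hsum : ∀ σ : ℝ, 1 < σ → LSeriesSummable (fun n => ((c n : ℝ) : ℂ)) σ := fun σ hσ =>
    LSeriesSummable_of_unitSlack hU1 hc hσ
  exact ⟨hsum, stub_continuation c hc hPNT hsum⟩

/-- **(KRH) modulo the exact prime-deficit theorem.** Suppose that every weight `c ≥ 0`, `c 1 = 0`, that is
exact-feasible against every Weil test and carries the (automatic) analytic package of
`exactWeight_continuation` has `Σ_p (log p - c(p))₊ p^{-σ} < ∞` for every `σ > 1/2` (W-MAG Thm 1.2(i) at zero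
slack). Then one exact-cone weight forces RH (`stub_transfer`, the Landau transfer). -/
theorem riemannHypothesis_of_exactWeight_of_primeDeficit
    (hD : ∀ c : ℕ → ℝ, (∀ n, 0 ≤ c n) → c 1 = 0 →
      (∀ φ : ℝ → ℂ, IsWeilTest φ →
        0 ≤ (weilPolarTerm (weilConv φ (weilReflect φ)) + weilArchTerm (weilConv φ (weilReflect φ)) -
            ∑' n : ℕ, ((c n : ℝ) : ℂ) / (Real.sqrt n : ℂ) *
              (weilConv φ (weilReflect φ) (Real.log n) + weilConv φ (weilReflect φ) (-Real.log n))).re) →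
      (∀ σ : ℝ, 1 < σ → LSeriesSummable (fun n => ((c n : ℝ) : ℂ)) σ) →
      (∀ s₀ : ℂ, 1 / 2 < s₀.re → ∃ η : ℝ, 0 < η ∧ ∃ F : ℂ → ℂ,
        DifferentiableOn ℂ F {s : ℂ | 1 / 2 < s.re ∧ s.re < s₀.re + 1 ∧ s₀.im - η < s.im ∧ s.im < s₀.im + η} ∧
        ∀ s ∈ {s : ℂ | 1 / 2 < s.re ∧ s.re < s₀.re + 1 ∧ s₀.im - η < s.im ∧ s.im < s₀.im + η},
          1 < s.re → F s = LSeries (fun n => ((c n : ℝ) : ℂ)) s - 1 / (s - 1)) →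
      ∀ σ : ℝ, 1 / 2 < σ →
        Summable (fun p : ℕ => if p.Prime then max (Real.log p - c p) 0 / (p : ℝ) ^ σ else 0))
    (hc : ∀ n, 0 ≤ c n) (hc1 : c 1 = 0)
    (hU0 : ∀ φ : ℝ → ℂ, IsWeilTest φ →
      0 ≤ (weilPolarTerm (weilConv φ (weilReflect φ)) + weilArchTerm (weilConv φ (weilReflect φ)) -
          ∑' n : ℕ, ((c n : ℝ) : ℂ) / (Real.sqrt n : ℂ) *
            (weilConv φ (weilReflect φ) (Real.log n) + weilConv φ (weilReflect φ) (-Real.log n))).re) :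
    RiemannHypothesis := by
  obtain ⟨hsum, hcont⟩ := exactWeight_continuation hc hU0
  exact stub_transfer c hc hsum hcont (hD c hc hc1 hU0 hsum hcont)

/-- **(KRH) modulo the exact surplus theorem** (archive fefr Thm B, surplus side). Suppose that every weight
`c ≥ 0`, `c 1 = 0`, exact-feasible against every Weil test (with its automatic analytic package) has
`Σ_n (c(n) - Λ(n))₊ n^{-σ} < ∞` for every `σ > 1/2`. Then one exact-cone weight forces RH
(`riemannHypothesis_of_fakeWeight_landau_surplus`). -/
theorem riemannHypothesis_of_exactWeight_of_surplus
    (hS : ∀ c : ℕ → ℝ, (∀ n, 0 ≤ c n) → c 1 = 0 →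
      (∀ φ : ℝ → ℂ, IsWeilTest φ →
        0 ≤ (weilPolarTerm (weilConv φ (weilReflect φ)) + weilArchTerm (weilConv φ (weilReflect φ)) -
            ∑' n : ℕ, ((c n : ℝ) : ℂ) / (Real.sqrt n : ℂ) *
              (weilConv φ (weilReflect φ) (Real.log n) + weilConv φ (weilReflect φ) (-Real.log n))).re) →
      (∀ σ : ℝ, 1 < σ → LSeriesSummable (fun n => ((c n : ℝ) : ℂ)) σ) →
      (∀ s₀ : ℂ, 1 / 2 < s₀.re → ∃ η : ℝ, 0 < η ∧ ∃ F : ℂ → ℂ,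
        DifferentiableOn ℂ F {s : ℂ | 1 / 2 < s.re ∧ s.re < s₀.re + 1 ∧ s₀.im - η < s.im ∧ s.im < s₀.im + η} ∧
        ∀ s ∈ {s : ℂ | 1 / 2 < s.re ∧ s.re < s₀.re + 1 ∧ s₀.im - η < s.im ∧ s.im < s₀.im + η},
          1 < s.re → F s = LSeries (fun n => ((c n : ℝ) : ℂ)) s - 1 / (s - 1)) →
      ∀ σ : ℝ, 1 / 2 < σ → LSeriesSummable (fun n => ((max (c n - Λ n) 0 : ℝ) : ℂ)) σ)
    (hc : ∀ n, 0 ≤ c n) (hc1 : c 1 = 0)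
    (hU0 : ∀ φ : ℝ → ℂ, IsWeilTest φ →
      0 ≤ (weilPolarTerm (weilConv φ (weilReflect φ)) + weilArchTerm (weilConv φ (weilReflect φ)) -
          ∑' n : ℕ, ((c n : ℝ) : ℂ) / (Real.sqrt n : ℂ) *
            (weilConv φ (weilReflect φ) (Real.log n) + weilConv φ (weilReflect φ) (-Real.log n))).re) :
    RiemannHypothesis := by
  obtain ⟨hsum, hcont⟩ := exactWeight_continuation hc hU0
  have hsur := hS c hc hc1 hU0 hsum hcont
  have hsum2 : LSeriesSummable (fun n => ((c n : ℝ) : ℂ)) ((2 : ℝ) : ℂ) := hsum 2 (by norm_num)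
  refine riemannHypothesis_of_fakeWeight_landau_surplus hc hsum2 (fun γ X => ?_) hsur
  -- the rectangle `(1/2, X) × (γ - η, γ + η)` inside the stub's rectangle through `s₀ = max X 1 + iγ`
  set s₀ : ℂ := ((max X 1 : ℝ) : ℂ) + γ * I with hs₀
  have hs₀re : s₀.re = max X 1 := by simp [hs₀]
  have hs₀im : s₀.im = γ := by simp [hs₀]
  obtain ⟨η, hη, F, hF, hFeq⟩ := hcont s₀ (by rw [hs₀re]; exact lt_of_lt_of_le one_half_lt_one (le_max_right _ _))
  have hsub : ({s : ℂ | 1 / 2 < s.re} ∩ {s : ℂ | s.re < X}) ∩ ({s : ℂ | s.im < γ + η} ∩ {s : ℂ | γ - η < s.im}) ⊆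
      {s : ℂ | 1 / 2 < s.re ∧ s.re < s₀.re + 1 ∧ s₀.im - η < s.im ∧ s.im < s₀.im + η} := by
    rintro s ⟨⟨h1, h2⟩, h3, h4⟩
    have h2' : s.re < X := h2
    have h3' : s.im < γ + η := h3
    have h4' : γ - η < s.im := h4
    refine ⟨h1, ?_, ?_, ?_⟩
    · rw [hs₀re]; linarith [le_max_left X 1]
    · rw [hs₀im]; exact h4'
    · rw [hs₀im]; exact h3'
  refine ⟨η, hη, F, hF.mono hsub, fun s hs hs2 hs1 => ?_⟩
  have h := hFeq s (hsub hs) (by linarith)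
  rw [h, one_div, sub_add_cancel]

end Summit.RiemannHypothesis.RiemannHypothesis.Theorems.SignConeExactConeRigidity
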